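import Summits.RiemannHypothesis.RiemannHypothesis.Theorems.Splittings.LiRephasingKit
import Summits.RiemannHypothesis.RiemannHypothesis.Theorems.Splittings.LiIncrHighPartSplit
import Literature.NumberTheory.LFunctions.CriticalLineTwoThirdsMatrixProofs
import Literature.NumberTheory.LFunctions.SoundZeroWindowSums
import HarnessLib

/-!
# LI B18 KERNEL Q1/6 — THE GAIN BUDGET, DOWNWARD ALIGNMENT, RANK CLASSES AND PIGEONHOLE (SketchG16B §1-D, §2, §3) — PURE / RH-FREE

PRE-CUT (not filed).  Lane (xi-q) «LI B18 KERNEL» ×6 = Q1 `LiRephasingGainBudget` → Q2 `LiOneStepRephasing` → Q3 `LiRephasingSchedule` →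
Q4 `LiRephasingScales` → Q5 `LiRephasingMovingCutPrelim` → Q6 `LiRephasingMovingCut` RESERVED by RULING #204 (rh-split lead g6,
2026-08-27T18:03:10Z): GO = (xi-p) `LiRephasingKit` ACCEPTED (p553624, 18:01:43Z) + referee g8 BYTES and negctl replay on the six carved shas;
LOWEST priority; filing words `--supports stmt-RiemannHypothesis-19649 --as helper`, kind auto, parts land in chain order.  Cell rh-split,
seat rh-split-li-bridge (kernel author g16, cutter g17; brief sha16 f79c5f09d8bcb036), card `run/shared/lean/pub/rh-split/cards/SPLIT-li-bridge.md`
§23 / 23.8 (model barrier B18 «INCREMENT-LEVEL RE-PHASING ⟂ COUNTING-LAW BRIDGES»).  Kernel source `HOME/rh-split-li-bridge/SketchG16B.lean`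
sha16 cf2b65fdbda323e2 (1639 l, ns `RhSplit.LiBridgeG16`, farm rc 0 · 0 err · 0 warn · 0 sorry, std axioms; §§1–6 = `SketchG16.lean`
355f955084e6fc2c byte-identical prefix, referee REPLAY PASS 17:02Z / RULING #176; §§7–9 referee REPLAY PASS 17:28:47Z / RULING #186);
cut plan `CARVE-16.md` 677f9696f1bd3382; reconstruction note `HOME/rh-split-li-bridge/carve-16/README.md` (CUT ONLY — no regeneration).
THIS PART = scratch ll.132–247 (§1-D: `amp_ge` … `gain_budget_ge`) and ll.249–393 (§2, §3)
↦ ll.56–317 here; decl text BYTE-VERBATIM (statements AND proofs, scratch section headers kept).  Deltas = namespace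
`RhSplit.LiBridgeG16` ↦ `Summit.RiemannHypothesis.RiemannHypothesis.Theorems.Splittings.LiRephasingGainBudget`, imports ((xi-p) `…Splittings.LiRephasingKit` + the scratch's three imports + HarnessLib),
this header, `set_option linter.dupNamespace false`, the `open` lines (the scratch's + `…Splittings.LiRephasingKit` + the earlier parts'
namespaces).  The six SketchG15B lemmas of scratch §1 (`exists_sin_eq_neg_one_of_phase_drop`, `four_sin_half_mul_sin`,
`sum_range_phase_telescope`, `abs_sum_range_phase_le`, `abs_sum_range_family_le`, `exists_le_on_block`) are CITED from the tree's
`LiRephasingKit` (lane (xi-p)), never restated.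

Content: §1-D THE GAIN BUDGET (g15): `amp_ge` (`4/(2t+1) ≤ 4 sin(θ_t/2)`), `dyadic_amp_mass_ge(')`, `chain_amp_mass_ge`,
`sum_log_dyadic_eq`, `gain_budget_ge` (`(J·log(T/2π) + log 2·J(J−1)/2)/13 ≤ Σ_{zone (T,2^J T]} m_ρ·4 sin(θ_γ/2)`, `T ≥ 260`, via the
tree's RH-free dyadic count `AlpogeFurman2026.dyadic_count_ge`); §2 DOWNWARD ALIGNMENT (`sin_half_angle_mono`,
`exists_realign_down(_sq)`: for `14 < x`, `16πx ≤ n+½` some `x' ∈ [x − 4πx²/(n+½), x]` has `sin((n+½)θ_{x'}) = −1`); §3 the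
RE-PHASED low sum `lowSumRe g n Y` (`lowSumRe (·.im) = lowSum`), rank classes `rank`/`sel`, PIGEONHOLE `exists_sel_ge`, SPREADING
(`rank_add_le_rank`, `le_card_between`, `mod_eq_of_mem_sel`) and block averaging `exists_index_le`.  3 defs, 18 theorems.

HONEST LABEL: SPLITTING SEARCH over kernel-typed RH-EQUIVALENCES; a splitting A ∧ B ⟹ RH is CONDITIONAL bookkeeping
unless A and B are both proved; nothing here bears on the truth of RH.  Every theorem below is PURE (trigonometry /
finite sums / calculus / parameter arithmetic) or RH-FREE (about the true zeta zeros, no hypothesis on their real parts);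
none is a claim about RH, PL or K7ev; the whole chain is BARRIER-SIDE bookkeeping (B18), not a conjunct toward RH.
-/

set_option linter.dupNamespace false

namespace Summit.RiemannHypothesis.RiemannHypothesis.Theorems.Splittings.LiRephasingGainBudget

open Real Set Finset
open Literature.NumberTheory.LFunctions Literature.NumberTheory.LFunctions.SchoenfeldBound
open Literature.NumberTheory.LFunctions.AlpogeFurman2026
open Literature.NumberTheory.LFunctions.SoundTest
open Summit.RiemannHypothesis.RiemannHypothesis.Theorems.LiTheory
open Summit.RiemannHypothesis.RiemannHypothesis.Theorems.Splittings
open Summit.RiemannHypothesis.RiemannHypothesis.Theorems.Splittings.LiIncrHighPart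
open Summit.RiemannHypothesis.RiemannHypothesis.Theorems.Splittings.LiRephasingKit

/-! ## §1-D The gain budget — VERBATIM from g15 (SketchG15C 12fa337523156e18 §§D1–D3; referee-replayed); the six
SketchG15B §§A–C lemmas of scratch §1 are NOT restated: they are the tree's `…Splittings.LiRephasingKit` (lane (xi-p), p553624). -/

/-- `sin(θ_t/2) = sin(arctan(1/(2t))) ≥ (1/(2t))/(1 + 1/(2t)) = 1/(2t+1)` for `t > 0`, i.e. `4/(2t+1) ≤ 4 sin(θ_t/2)`. PURE. -/
theorem amp_ge {t : ℝ} (ht : 0 < t) : 4 / (2 * t + 1) ≤ 4 * Real.sin (liZeroAngle t / 2) := by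
  have hx : 0 < 1 / (2 * t) := by positivity
  have hθ : liZeroAngle t / 2 = Real.arctan (1 / (2 * t)) := by unfold liZeroAngle; ring
  rw [hθ, Real.sin_arctan]
  set x : ℝ := 1 / (2 * t) with hxdef
  have hsq : Real.sqrt (1 + x ^ 2) ≤ 1 + x := by
    calc Real.sqrt (1 + x ^ 2) ≤ Real.sqrt ((1 + x) ^ 2) := Real.sqrt_le_sqrt (by nlinarith)
      _ = 1 + x := Real.sqrt_sq (by linarith)
  have hpos : 0 < Real.sqrt (1 + x ^ 2) := Real.sqrt_pos.2 (by positivity)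
  have h1 : x / (1 + x) ≤ x / Real.sqrt (1 + x ^ 2) := div_le_div_of_nonneg_left hx.le hpos hsq
  have h2 : 4 / (2 * t + 1) = 4 * (x / (1 + x)) := by
    rw [hxdef]; field_simp
  rw [h2]
  linarith

/-- **DYADIC AMPLITUDE MASS LAW (RH-FREE).**  For `T ≥ 260`:
`(T·log(T/2π)/(4π)) · 4/(4T+1) ≤ Σ_{ρ : T < γ ≤ 2T} m_ρ · 4 sin(θ_γ/2)` — the explicit dyadic zero count
`N(2T) − N(T) ≥ T log(T/2π)/(4π)` (Literature `AlpogeFurman2026.dyadic_count_ge`, Backlund–Trudgian) times the least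
amplitude `4/(4T+1)` on the block. RH-FREE. -/
theorem dyadic_amp_mass_ge {T : ℝ} (hT : 260 ≤ T) :
    T * logHeight T / (4 * π) * (4 / (4 * T + 1)) ≤
      ∑ ρ ∈ zerosBetween T (2 * T), mult ρ * (4 * Real.sin (liZeroAngle ρ.im / 2)) := by
  have hT0 : 0 < T := by linarith
  have hcount := dyadic_count_ge hT
  have hsum : ∑ ρ ∈ zerosBetween T (2 * T), mult ρ = (zetaZeroCount (2 * T) : ℝ) - zetaZeroCount T := by
    unfold mult
    exact (zetaZeroCount_sub_eq_sum (by linarith)).symm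
  have hterm : ∀ ρ ∈ zerosBetween T (2 * T),
      mult ρ * (4 / (4 * T + 1)) ≤ mult ρ * (4 * Real.sin (liZeroAngle ρ.im / 2)) := by
    intro ρ hρ
    obtain ⟨-, -, -, h1, h2⟩ := (mem_zerosBetween hT0.le).1 hρ
    have hm : 0 ≤ mult ρ := zeroOrder_nonneg_of_mem_zerosBetween hT0.le hρ
    have hγ : 0 < ρ.im := by linarith
    have hmono : 4 / (4 * T + 1) ≤ 4 / (2 * ρ.im + 1) :=
      div_le_div_of_nonneg_left (by norm_num) (by positivity) (by linarith)
    exact mul_le_mul_of_nonneg_left (hmono.trans (amp_ge hγ)) hm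
  calc T * logHeight T / (4 * π) * (4 / (4 * T + 1))
      ≤ ((zetaZeroCount (2 * T) : ℝ) - zetaZeroCount T) * (4 / (4 * T + 1)) :=
        mul_le_mul_of_nonneg_right hcount (by positivity)
    _ = ∑ ρ ∈ zerosBetween T (2 * T), mult ρ * (4 / (4 * T + 1)) := by rw [← hsum, Finset.sum_mul]
    _ ≤ _ := Finset.sum_le_sum hterm

/-- The amplitude mass is nonnegative on every window `(a, b]`, `0 ≤ a`. RH-FREE. -/
theorem amp_mass_nonneg {a b : ℝ} (ha : 0 ≤ a) :
    0 ≤ ∑ ρ ∈ zerosBetween a b, mult ρ * (4 * Real.sin (liZeroAngle ρ.im / 2)) := by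
  refine Finset.sum_nonneg fun ρ hρ ↦ ?_
  obtain ⟨-, -, -, h1, -⟩ := (mem_zerosBetween ha).1 hρ
  have hγ : 0 < ρ.im := by linarith
  have hm : 0 ≤ mult ρ := zeroOrder_nonneg_of_mem_zerosBetween ha hρ
  exact mul_nonneg hm (by linarith [amp_ge hγ, show (0:ℝ) < 4 / (2 * ρ.im + 1) by positivity])

/-- **Clean form (RH-FREE).**  For `T ≥ 260`: `log(T/2π)/13 ≤ Σ_{T<γ≤2T} m_ρ · 4 sin(θ_γ/2)`
(`4T/(4T+1) ≥ 1040/1041` and `4π · 1041/1040 < 13`). -/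
theorem dyadic_amp_mass_ge' {T : ℝ} (hT : 260 ≤ T) :
    Real.log (T / (2 * π)) / 13 ≤ ∑ ρ ∈ zerosBetween T (2 * T), mult ρ * (4 * Real.sin (liZeroAngle ρ.im / 2)) := by
  have h := dyadic_amp_mass_ge hT
  have hπ := Real.pi_lt_d4
  have hπ0 := Real.pi_pos
  have hL : 0 ≤ logHeight T := by
    unfold logHeight
    exact Real.log_nonneg (by rw [le_div_iff₀ (by positivity)]; nlinarith)
  have hcoef : (1 : ℝ) / 13 ≤ T / (4 * π) * (4 / (4 * T + 1)) := by
    rw [div_mul_div_comm, div_le_div_iff₀ (by norm_num) (by positivity)]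
    nlinarith
  have e : T * logHeight T / (4 * π) * (4 / (4 * T + 1)) = logHeight T * (T / (4 * π) * (4 / (4 * T + 1))) := by ring
  rw [e] at h
  have : Real.log (T / (2 * π)) / 13 = logHeight T * (1 / 13) := by unfold logHeight; ring
  rw [this]
  exact (mul_le_mul_of_nonneg_left hcoef hL).trans h

/-- **CHAIN LAW (RH-FREE).**  For `T ≥ 260` and every `J`:
`Σ_{j<J} log(2^j T/2π)/13 ≤ Σ_{T<γ≤2^J T} m_ρ · 4 sin(θ_γ/2)`. -/
theorem chain_amp_mass_ge {T : ℝ} (hT : 260 ≤ T) (J : ℕ) :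
    ∑ j ∈ Finset.range J, Real.log (2 ^ j * T / (2 * π)) / 13 ≤
      ∑ ρ ∈ zerosBetween T (2 ^ J * T), mult ρ * (4 * Real.sin (liZeroAngle ρ.im / 2)) := by
  have hT0 : 0 < T := by linarith
  induction J with
  | zero => simp only [Finset.range_zero, Finset.sum_empty]; exact amp_mass_nonneg hT0.le
  | succ J ih =>
    have hJT : 260 ≤ 2 ^ J * T := by
      have : (1 : ℝ) ≤ 2 ^ J := one_le_pow₀ (by norm_num)
      nlinarith
    have hsplit := sum_zerosBetween_split hT0.le
      (by have : (1 : ℝ) ≤ 2 ^ J := one_le_pow₀ (by norm_num); nlinarith : T ≤ 2 ^ J * T)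
      (by rw [pow_succ]; nlinarith [show (0:ℝ) < 2 ^ J * T by positivity] : 2 ^ J * T ≤ 2 ^ (J + 1) * T)
      (fun ρ ↦ mult ρ * (4 * Real.sin (liZeroAngle ρ.im / 2)))
    rw [Finset.sum_range_succ, hsplit]
    have hblock := dyadic_amp_mass_ge' hJT
    rw [show 2 * (2 ^ J * T) = 2 ^ (J + 1) * T by rw [pow_succ]; ring] at hblock
    linarith

/-- The bookkeeping of the left side: `Σ_{j<J} log(2^j T/2π) = J·log(T/2π) + (log 2)·(J(J−1)/2)` (`T > 0`). PURE. -/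
theorem sum_log_dyadic_eq {T : ℝ} (hT : 0 < T) (J : ℕ) :
    ∑ j ∈ Finset.range J, Real.log (2 ^ j * T / (2 * π)) =
      J * Real.log (T / (2 * π)) + Real.log 2 * (J * (J - 1) / 2) := by
  have hlog : ∀ j : ℕ, Real.log (2 ^ j * T / (2 * π)) = j * Real.log 2 + Real.log (T / (2 * π)) := by
    intro j
    rw [mul_div_assoc, Real.log_mul (by positivity) (by positivity), Real.log_pow]
  simp_rw [hlog]
  induction J with
  | zero => simp
  | succ J ih =>
    rw [Finset.sum_range_succ, ih]
    push_cast
    ring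

/-- **THE GAIN BUDGET (RH-FREE).**  For `T ≥ 260` and every `J`:
`(J·log(T/2π) + (log 2)·J(J−1)/2)/13 ≤ Σ_{T<γ≤2^J T} m_ρ · 4 sin(θ_γ/2)` — the amplitude mass of the zeta ordinates
over `J` dyadic blocks is `≫ J²`, i.e. `≫ log²(T'/T)` over `(T, T']`: the budget from which THEOREM A (b) draws `> ½ log N`
on every `m`-th zero, `m ≍ log N`. RH-FREE. -/
theorem gain_budget_ge {T : ℝ} (hT : 260 ≤ T) (J : ℕ) :
    (J * Real.log (T / (2 * π)) + Real.log 2 * (J * (J - 1) / 2)) / 13 ≤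
      ∑ ρ ∈ zerosBetween T (2 ^ J * T), mult ρ * (4 * Real.sin (liZeroAngle ρ.im / 2)) := by
  have h := chain_amp_mass_ge hT J
  rwa [← Finset.sum_div, sum_log_dyadic_eq (by linarith) J] at h

/-! ## §2 Downward alignment and amplitude monotonicity — PURE -/

/-- The amplitude `4 sin(θ_t/2)`, `θ_t/2 = arctan(1/(2t))`, only GROWS when the ordinate is LOWERED:
`sin(θ_t/2) ≤ sin(θ_{t'}/2)` for `0 < t' ≤ t`. PURE. -/
theorem sin_half_angle_mono {t t' : ℝ} (ht' : 0 < t') (htt : t' ≤ t) :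
    Real.sin (liZeroAngle t / 2) ≤ Real.sin (liZeroAngle t' / 2) := by
  have e : ∀ s : ℝ, liZeroAngle s / 2 = Real.arctan (1 / (2 * s)) := fun s ↦ by unfold liZeroAngle; ring
  rw [e, e]
  refine Real.sin_le_sin_of_le_of_le_pi_div_two (Real.neg_pi_div_two_lt_arctan _).le
    (Real.arctan_lt_pi_div_two _).le (Real.arctan_mono ?_)
  exact div_le_div_of_nonneg_left (by norm_num) (by positivity) (by linarith)

/-- **DOWNWARD ALIGNMENT LEMMA.** If `1 ≤ x − d`, `0 < d` and `4π x² ≤ (n+½) d`, then some `x' ∈ [x − d, x]` has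
`sin((n+½)·θ(x')) = −1`: the phase `(n+½)θ` drops by `≥ (n+½)·d/(2x²) ≥ 2π` across `[x−d, x]` (tree
`LiLowZeroBudget.phase_sub_ge`, mean value at the UPPER end point — four times cheaper than the upward move of g15). PURE. -/
theorem exists_realign_down {x d : ℝ} (n : ℕ) (hxd : 1 ≤ x - d) (hd : 0 < d)
    (hreach : 4 * π * x ^ 2 ≤ ((n : ℝ) + 1 / 2) * d) :
    ∃ x' ∈ Icc (x - d) x, Real.sin (((n : ℝ) + 1 / 2) * liZeroAngle x') = -1 := by
  refine exists_sin_eq_neg_one_of_phase_drop (φ := fun t ↦ ((n : ℝ) + 1 / 2) * liZeroAngle t)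
    (by linarith) ?_ ?_
  · intro t ht
    have ht0 : t ≠ 0 := by linarith [ht.1]
    exact (continuousWithinAt_const.mul
      (hasDerivAt_liZeroAngle ht0).continuousAt.continuousWithinAt)
  · have h1 := LiLowZeroBudget.phase_sub_ge hxd (by linarith : x - d < x)
    have hx : 0 < x := by linarith
    have h2 : 2 * π ≤ ((n : ℝ) + 1 / 2) * ((x - (x - d)) / (2 * x ^ 2)) := by
      rw [show x - (x - d) = d by ring, mul_div_assoc', le_div_iff₀ (by positivity)]
      nlinarith [hreach]
    have hn : (0 : ℝ) ≤ (n : ℝ) + 1 / 2 := by positivity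
    have h3 := mul_le_mul_of_nonneg_left h1 hn
    show ((n : ℝ) + 1 / 2) * liZeroAngle x + 2 * π ≤ ((n : ℝ) + 1 / 2) * liZeroAngle (x - d)
    nlinarith [h2, h3]

/-- **DOWNWARD ALIGNMENT IN THE REACHABLE ZONE:** for `14 < x` and `16π x ≤ n + ½` there is `x'` with
`x − 4πx²/(n+½) ≤ x' ≤ x`, `1 ≤ x'` (indeed `x' ≥ 3x/4`) and `sin((n+½)θ(x')) = −1`. PURE. -/
theorem exists_realign_down_sq {x : ℝ} (n : ℕ) (hx : 14 < x) (hn : 16 * π * x ≤ (n : ℝ) + 1 / 2) :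
    ∃ x' : ℝ, x - 4 * π * x ^ 2 / ((n : ℝ) + 1 / 2) ≤ x' ∧ x' ≤ x ∧ 1 ≤ x' ∧
      Real.sin (((n : ℝ) + 1 / 2) * liZeroAngle x') = -1 := by
  set d := 4 * π * x ^ 2 / ((n : ℝ) + 1 / 2) with hd
  have hn0 : (0 : ℝ) < (n : ℝ) + 1 / 2 := by positivity
  have hx0 : 0 < x := by linarith
  have hdpos : 0 < d := by positivity
  have hnd : ((n : ℝ) + 1 / 2) * d = 4 * π * x ^ 2 := by rw [hd]; field_simp
  have hdx : d ≤ x / 4 := by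
    rw [hd, div_le_iff₀ hn0]
    nlinarith [hn, hx0, Real.pi_pos]
  have hxd : 1 ≤ x - d := by linarith
  obtain ⟨x', hx', hs⟩ := exists_realign_down n hxd hdpos (le_of_eq hnd.symm)
  exact ⟨x', hx'.1, hx'.2, by linarith [hx'.1], hs⟩

/-! ## §3 Re-phased low sums, rank classes, pigeonhole and spreading -/

/-- The RE-PHASED low sum: `lowSum n Y` with the ordinate of each zero `ρ` replaced by `g ρ` inside the phase and the
amplitude (the multiplicities and the index set `zerosBetween 0 Y` are kept). `lowSumRe (·.im) = lowSum`. -/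
noncomputable def lowSumRe (g : ℂ → ℝ) (n : ℕ) (Y : ℝ) : ℝ :=
  ∑ ρ ∈ zerosBetween 0 Y,
    mult ρ * (4 * Real.sin (liZeroAngle (g ρ) / 2) * Real.sin (((n : ℝ) + 1 / 2) * liZeroAngle (g ρ)))

/-- The identity re-phasing gives back the tree's `lowSum`. PURE. -/
theorem lowSumRe_im (n : ℕ) (Y : ℝ) : lowSumRe (fun ρ ↦ ρ.im) n Y = lowSum n Y := by
  unfold lowSumRe lowSum
  exact Finset.sum_congr rfl fun ρ _ ↦ by ring

/-- The RANK of `ρ` in `Z`: the number of zeros of `Z` (as points of `ℂ`) with strictly smaller ordinate. -/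
noncomputable def rank (Z : Finset ℂ) (ρ : ℂ) : ℕ := (Z.filter (fun ρ' ↦ ρ'.im < ρ.im)).card

/-- The rank class `c (mod m)` of `Z` — «every `m`-th zero». -/
noncomputable def sel (Z : Finset ℂ) (m c : ℕ) : Finset ℂ := Z.filter (fun ρ ↦ rank Z ρ % m = c)

/-- A rank class is a sub-multiset of `Z`: `sel Z m c ⊆ Z`. PURE. -/
theorem sel_subset (Z : Finset ℂ) (m c : ℕ) : sel Z m c ⊆ Z := Finset.filter_subset _ _

/-- **PIGEONHOLE over rank classes:** some class carries at least `1/m` of any weight on `Z` (`0 < m`). PURE. -/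
theorem exists_sel_ge (Z : Finset ℂ) (w : ℂ → ℝ) {m : ℕ} (hm : 0 < m) :
    ∃ c < m, (∑ ρ ∈ Z, w ρ) / m ≤ ∑ ρ ∈ sel Z m c, w ρ := by
  have hmaps : ∀ ρ ∈ Z, rank Z ρ % m ∈ Finset.range m := fun ρ _ ↦ Finset.mem_range.2 (Nat.mod_lt _ hm)
  have htot : ∑ c ∈ Finset.range m, ∑ ρ ∈ sel Z m c, w ρ = ∑ ρ ∈ Z, w ρ :=
    Finset.sum_fiberwise_of_maps_to hmaps w
  have hm0 : (m : ℝ) ≠ 0 := by exact_mod_cast hm.ne'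
  have hconst : ∑ _c ∈ Finset.range m, (∑ ρ ∈ Z, w ρ) / m = ∑ ρ ∈ Z, w ρ := by
    rw [Finset.sum_const, Finset.card_range, nsmul_eq_mul]; field_simp
  obtain ⟨c, hc, hle⟩ := Finset.exists_le_of_sum_le (Finset.nonempty_range_iff.2 hm.ne')
    (le_of_eq (hconst.trans htot.symm))
  exact ⟨c, Finset.mem_range.1 hc, hle⟩

/-- Rank is strictly increasing along the ordinates of `Z`. PURE. -/
theorem rank_lt_rank {Z : Finset ℂ} {ρ ρ' : ℂ} (hρ : ρ ∈ Z) (h : ρ.im < ρ'.im) : rank Z ρ < rank Z ρ' := by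
  unfold rank
  apply Finset.card_lt_card
  rw [Finset.ssubset_iff_of_subset]
  · exact ⟨ρ, Finset.mem_filter.2 ⟨hρ, h⟩, fun h' ↦ lt_irrefl _ (Finset.mem_filter.1 h').2⟩
  · intro σ hσ
    rw [Finset.mem_filter] at hσ ⊢
    exact ⟨hσ.1, hσ.2.trans h⟩

/-- **SPREADING:** two zeros of the same rank class with different ordinates differ in rank by at least `m`. PURE. -/
theorem rank_add_le_rank {Z : Finset ℂ} {m : ℕ} {ρ ρ' : ℂ} (hρ : ρ ∈ Z) (h : ρ.im < ρ'.im)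
    (hc : rank Z ρ % m = rank Z ρ' % m) : rank Z ρ + m ≤ rank Z ρ' := by
  have hlt := rank_lt_rank hρ h
  have hdvd : m ∣ rank Z ρ' - rank Z ρ :=
    Nat.dvd_of_mod_eq_zero (Nat.sub_mod_eq_zero_of_mod_eq hc.symm)
  have hle := Nat.le_of_dvd (Nat.sub_pos_of_lt hlt) hdvd
  omega

/-- **SPREADING, counted:** between two selected ordinates `γ < γ'` of the same class lie at least `m` zeros of `Z`
(ordinates in `[γ, γ')`) — the selected class has density `≤ 1/m` along `Z`. PURE. -/
theorem le_card_between {Z : Finset ℂ} {m : ℕ} {ρ ρ' : ℂ} (hρ : ρ ∈ Z) (h : ρ.im < ρ'.im)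
    (hc : rank Z ρ % m = rank Z ρ' % m) :
    m ≤ (Z.filter (fun σ ↦ ρ.im ≤ σ.im ∧ σ.im < ρ'.im)).card := by
  have h1 := rank_add_le_rank hρ h hc
  unfold rank at h1
  have hsub : Z.filter (fun σ ↦ σ.im < ρ.im) ⊆ Z.filter (fun σ ↦ σ.im < ρ'.im) := by
    intro σ hσ
    rw [Finset.mem_filter] at hσ ⊢
    exact ⟨hσ.1, hσ.2.trans h⟩
  have hsd : Z.filter (fun σ ↦ σ.im < ρ'.im) \ Z.filter (fun σ ↦ σ.im < ρ.im) =
      Z.filter (fun σ ↦ ρ.im ≤ σ.im ∧ σ.im < ρ'.im) := by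
    ext σ
    simp only [Finset.mem_sdiff, Finset.mem_filter, not_and, not_lt]
    constructor
    · rintro ⟨⟨hz, hlt⟩, hn⟩
      exact ⟨hz, hn hz, hlt⟩
    · rintro ⟨hz, hle, hlt⟩
      exact ⟨⟨hz, hlt⟩, fun _ ↦ hle⟩
  have hcard := Finset.card_sdiff_of_subset hsub
  rw [hsd] at hcard
  omega

/-- Members of a class in the selection `sel Z m c` share their residue. PURE. -/
theorem mod_eq_of_mem_sel {Z : Finset ℂ} {m c : ℕ} {ρ ρ' : ℂ} (hρ : ρ ∈ sel Z m c) (hρ' : ρ' ∈ sel Z m c) :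
    rank Z ρ % m = rank Z ρ' % m := by
  rw [sel, Finset.mem_filter] at hρ hρ'
  rw [hρ.2, hρ'.2]

/-- **AVERAGING an unmoved family over the block `[N, 2N)`:** some index `N + i`, `i < N`, does at most the average
`4 Σ w / N` (no-drift law + `exists_le_on_block`). PURE. -/
theorem exists_index_le {α : Type*} (C : Finset α) (w θ : α → ℝ) (hw : ∀ a ∈ C, 0 ≤ w a) {N : ℕ} (hN : 0 < N) :
    ∃ i ∈ Finset.range N,
      ∑ a ∈ C, w a * (4 * Real.sin (θ a / 2) * Real.sin ((((N + i : ℕ) : ℝ) + 1 / 2) * θ a)) ≤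
        4 * (∑ a ∈ C, w a) / N := by
  have h := (le_abs_self _).trans (abs_sum_range_family_le C w θ hw N N)
  have hN0 : (N : ℝ) ≠ 0 := by exact_mod_cast hN.ne'
  refine exists_le_on_block (Finset.nonempty_range_iff.2 hN.ne') (h.trans (le_of_eq ?_))
  rw [Finset.sum_const, Finset.card_range, nsmul_eq_mul]
  field_simp

end Summit.RiemannHypothesis.RiemannHypothesis.Theorems.Splittings.LiRephasingGainBudget
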